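import Summits.QuantumFields.YangMills.Theorems.CovariantDischargeTruncatedPotentialPairing
import Summits.QuantumFields.YangMills.Theorems.CovariantDischargeGreenPotentialL2
import Summits.QuantumFields.YangMills.Theorems.UnitScaleGibbsTestFieldSU2DressingFlatPairing
import Summits.QuantumFields.YangMills.Theorems.UnitScaleGibbsChartPairingDictionary
import Summits.QuantumFields.YangMills.Theorems.GrossTransferStubLinTestSDTerm
import HarnessLib

/-!
# `GrossTransferStubLinTestPointwisePairing` — R8-P8 OF `stub_linTest`'s POINTWISE PACKAGE, PART (I-a): THE PAIRING IDENTITY ON `ℤ^d` AND THE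
# SCHWINGER–DYSON TERM READ ON THE TORUS (LINE 28 «GrossTransfer» v3.2, skeleton of record `Cruxes/HistoryTailL/Lines/gross_transfer.lean`;
# crux `RevelationMartingale.MeanDeviationL` stmt-QuantumFields-23083 ∕ `UnitScaleTilt.HistoryTailL` stmt-QuantumFields-19936)

Cell `ym3-torus` (YM ladder rung R3 = continuum SU(2) Yang–Mills on T³ — a RUNG, NOT the Clay problem: not d = 4, not infinite volume, not a
mass gap); width seat `ym3-torus-px13` (gen 12), pen on `main_estimate` (LEAD ★w1-19936 2026-08-30T00:19:30Z, ★★OWNER WORD 65), helper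
`--supports stmt-QuantumFields-23083`.  The pen's `main_estimate` is ONE theorem of ≈ 1 400 lines; the gate's file-length rule (≤ 400 l.) forces a
LETTERS-STYLE SPLIT into row lemmas (ym-ust-19936-w2 g16's plan W∕Q∕I∕P∕MAIN): this file is (I-a).  THEOREMS ONLY (0 `def`, 0 `sorry`, default heartbeats).

WHAT.  In the letters of the package (the cone read-out `wt` on `Q_{ℓ0}(z₀)`, its half-Green potential `βt`, `at' = δ₂βt`, `γt = d₂βt`, the cutoff `χ`
(`= 1` on `Q_R`, `= 0` off `Q_{3R}`), `aR = χ·at'`, `daR` its curl, the commutators `E₁`, `C₂`, `σ = E₁ − C₂`):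
* §1 ★★`wt_pairing_eq` — for EVERY test 2-form `G` on `ℤ^d` (`d ≥ 3`):
  `Σ_{Q_{ℓ0}} wt·G = Σ_{Q_{3R+2}} daR·G + Σ_{Q_{3R+2}}Σ_κ (χγt)·∇_κG − Σ_{Q_{3R+2}} σ·G`
  (✓(Z-e) `CovariantDischargeTruncatedPotentialPairing.sum_curl_truncated_mul_eq` with `hΔ` from ✓`CovariantDischargeGreenPotentialL2.poisson_of_halfGreen_conv`,
  the `wt`-term restricted to its support, and `σ = E₁ − C₂` matched to the identity's two commutator terms);
* §2 ★`sum_curl_readout_eq_half_box` — the torus curl-pairing of the push `u0` of `aR` against any plaquette function, read on `ℤ^d`, is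
  `½·Σ_{Q_{3R+2}}Σ_μΣ_ν daR·F̂` for the antisymmetrised read-out `F̂` (✓`sum_sum_eq_two_mul_sum_lt`; `daR = 0` off `Q_{3R+1}`; `Q_{3R+2} ⊆ Π[lo,hi]` = ✓`GrossTransferStubLinTestSDTerm.box_subset_piFinset`);
* §3 ★★★`sd_term_abs_le` — THE SCHWINGER–DYSON ROW IN `ℤ^d` CURRENCY: on the `θ`-small dressing box, for the dressed push `u_α = u0•(iσ_α)` and
  `V = U^{axialGauge U lo hi}`: `|∂_{u_α}A(V) + ¼·Σ_{Q_{3R+2}}ΣΣ daR·F̂^α| ≤ 14·((d−1)nθ)·θ·(4(d−1)·Σ_{Π[lo,hi]}Σ_μ|aR|)`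
  (✓w5 DRESS-3 `abs_actionDeriv_push_dress_add_half_pairingZ_le` END-TO-END + §2).

HONEST SCOPE.  Finite-sum algebra about ONE configuration; proves no stub: `stub_linTest`, its pointwise package, `MeanDeviationL` 23083, `HistoryTailL` 19936,
the rung `YM3TorusSU2` are NOT proved; no summit statement is proved; the Yang–Mills mass gap is NOT proved.
References: [GrossCMP1983] Thm 2.2 (summation by parts for lattice gauge observables); [Balaban1984PropagatorsII] (1.9) p. 226 (lattice forms);
[Balaban1985Averaging] (9), (19)–(20) pp. 18–21 (plaquette variables, `dist₁`).
-/

noncomputable section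

set_option autoImplicit false

open scoped BigOperators Matrix.Norms.L2Operator
open Complex Finset
open Literature.Probability.LatticeModels (latticeGreen)
open Literature.MathematicalPhysics.QuantumFieldTheory.Balaban1983to89
open Literature.MathematicalPhysics.QuantumFieldTheory.Balaban1983to89.B4Eq19LatticeOperators (Zd unitVec box mem_box box_mono abs_unitVec_apply_le)
open Literature.MathematicalPhysics.QuantumFieldTheory.Balaban1983to89.T4AxialGaugeSmallField (castSite boxPlaqs axialGauge)
open Literature.MathematicalPhysics.QuantumFieldTheory.Balaban1983to89.B7Prop1Explicit (e)
open Literature.MathematicalPhysics.QuantumFieldTheory.Balaban1983to89.B10Eq18SigmaSU2 (pauli)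
open Literature.MathematicalPhysics.QuantumLattice (fundamentalRep)
open Summit.QuantumFields.YangMills.Theorems.UnitScaleGibbsActionDerivativeSlotCalculus (actionDeriv)

namespace Summit.QuantumFields.YangMills.Theorems.GrossTransferStubLinTestPointwisePairing

/-! ## §1 The pairing identity on `ℤ^d` -/

/-- ★★ **THE PAIRING IDENTITY.**  With the package's letters (`wt` supported in `Q_{ℓ0}(z₀)`, `βt = (G∕2)∗wt`, `at' = δ₂βt`, `γt = d₂βt`, cutoff `χ = 1` on
`Q_R(z₀)` and `= 0` off `Q_{3R}(z₀)`, `ℓ0 ≤ R`, `aR = χ·at'`, `daR` its curl, `E₁`∕`C₂` the cutoff commutators, `σ = E₁ − C₂`), for every 2-form `G`: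
`Σ_{Q_{ℓ0}}ΣΣ wt·G = Σ_{Q_{3R+2}}ΣΣ daR·G + Σ_{Q_{3R+2}}ΣΣΣ (χγt)·(G(·+e_κ) − G) − Σ_{Q_{3R+2}}ΣΣ σ·G`.
[cite: Balaban1984PropagatorsII, (1.9) p.226] [cite: GrossCMP1983, Thm 2.2] -/
theorem wt_pairing_eq {d : ℕ} (hd : 3 ≤ d) (z₀ : Zd d) (ℓ0 R : ℕ) (hℓR : (ℓ0 : ℤ) ≤ R)
    (wt βt : Zd d → Fin d → Fin d → ℝ) (at' : Zd d → Fin d → ℝ) (γt : Zd d → Fin d → Fin d → Fin d → ℝ)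
    (hwt_off : ∀ x, x ∉ box z₀ (ℓ0 : ℤ) → ∀ μ ν, wt x μ ν = 0)
    (hβt : ∀ x μ ν, βt x μ ν = ∑ y ∈ box z₀ (ℓ0 : ℤ), latticeGreen (x - y) / 2 * wt y μ ν)
    (hat : ∀ x ν, at' x ν = ∑ μ, (βt (x - unitVec μ) μ ν - βt x μ ν))
    (hγt : ∀ x κ μ ν, γt x κ μ ν = (βt (x + unitVec κ) μ ν - βt x μ ν) - (βt (x + unitVec μ) κ ν - βt x κ ν) + (βt (x + unitVec ν) κ μ - βt x κ μ))
    (χ : Zd d → ℝ) (hχ1 : ∀ x ∈ box z₀ (R : ℤ), χ x = 1) (hχ0 : ∀ x, x ∉ box z₀ (3 * (R : ℤ)) → χ x = 0)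
    (aR : Zd d → Fin d → ℝ) (daR : Zd d → Fin d → Fin d → ℝ) (haR : ∀ x ν, aR x ν = χ x * at' x ν)
    (hdaR : ∀ x μ ν, daR x μ ν = (aR (x + unitVec μ) ν - aR x ν) - (aR (x + unitVec ν) μ - aR x μ))
    (E1 C2 σ : Zd d → Fin d → Fin d → ℝ)
    (hE1 : ∀ x μ ν, E1 x μ ν = (χ (x + unitVec μ) - χ x) * at' (x + unitVec μ) ν - (χ (x + unitVec ν) - χ x) * at' (x + unitVec ν) μ)
    (hC2 : ∀ x μ ν, C2 x μ ν = ∑ κ, (χ x - χ (x - unitVec κ)) * γt (x - unitVec κ) κ μ ν)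
    (hσ : ∀ x μ ν, σ x μ ν = E1 x μ ν - C2 x μ ν)
    (G : Zd d → Fin d → Fin d → ℝ) :
    ∑ y ∈ box z₀ (ℓ0 : ℤ), ∑ μ, ∑ ν, wt y μ ν * G y μ ν
      = ∑ y ∈ box z₀ (3 * (R : ℤ) + 2), ∑ μ, ∑ ν, daR y μ ν * G y μ ν
        + ∑ y ∈ box z₀ (3 * (R : ℤ) + 2), ∑ κ, ∑ μ, ∑ ν, (χ y * γt y κ μ ν) * (G (y + unitVec κ) μ ν - G y μ ν)
        - ∑ y ∈ box z₀ (3 * (R : ℤ) + 2), ∑ μ, ∑ ν, σ y μ ν * G y μ ν := by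
  have hΔ : ∀ x μ ν, wt x μ ν = ∑ κ, (2 * βt x μ ν - βt (x + unitVec κ) μ ν - βt (x - unitVec κ) μ ν) :=
    CovariantDischargeGreenPotentialL2.poisson_of_halfGreen_conv hd wt βt z₀ (ℓ0 : ℤ) hwt_off hβt
  have h4 := CovariantDischargeTruncatedPotentialPairing.sum_curl_truncated_mul_eq wt βt at' γt χ aR daR z₀ (ℓ0 : ℤ) (R : ℤ)
    (3 * (R : ℤ)) (3 * (R : ℤ) + 2) hwt_off hℓR le_rfl hΔ hat hγt hχ1 hχ0 haR hdaR G
  -- the `wt`-term lives on `Q_{ℓ0} ⊆ Q_{3R+2}`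
  have h4w : ∑ y ∈ box z₀ (3 * (R : ℤ) + 2), ∑ μ, ∑ ν, wt y μ ν * G y μ ν = ∑ y ∈ box z₀ (ℓ0 : ℤ), ∑ μ, ∑ ν, wt y μ ν * G y μ ν := by
    have hR0 : (0 : ℤ) ≤ R := Nat.cast_nonneg R
    symm
    refine Finset.sum_subset (box_mono z₀ (by linarith only [hℓR, hR0])) fun y _ hy => ?_
    exact Finset.sum_eq_zero fun μ _ => Finset.sum_eq_zero fun ν _ => by rw [hwt_off y hy μ ν, zero_mul]
  -- `σ = E₁ − C₂` matches the two commutator terms of the identity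
  have hcol : ∑ y ∈ box z₀ (3 * (R : ℤ) + 2), ∑ μ, ∑ ν, σ y μ ν * G y μ ν
      = ∑ y ∈ box z₀ (3 * (R : ℤ) + 2), ∑ μ, ∑ ν,
            ((χ (y + unitVec μ) - χ y) * at' (y + unitVec μ) ν - (χ (y + unitVec ν) - χ y) * at' (y + unitVec ν) μ) * G y μ ν
        - ∑ y ∈ box z₀ (3 * (R : ℤ) + 2), ∑ μ, ∑ ν, (∑ κ, (χ y - χ (y - unitVec κ)) * γt (y - unitVec κ) κ μ ν) * G y μ ν := by
    rw [← Finset.sum_sub_distrib]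
    refine Finset.sum_congr rfl fun y _ => ?_
    rw [← Finset.sum_sub_distrib]
    refine Finset.sum_congr rfl fun μ _ => ?_
    rw [← Finset.sum_sub_distrib]
    refine Finset.sum_congr rfl fun ν _ => ?_
    rw [hσ, hE1, hC2]; ring
  rw [← h4w, hcol]
  linarith only [h4]

/-! ## §2 The torus curl-pairing of the push, read on `ℤ^d` -/

variable {P : Params}

/-- Membership one step up: if `y + e_κ ∈ Q_S(z₀)` then `y ∈ Q_{S+1}(z₀)`. [folklore] -/
theorem mem_box_succ_of_add_unitVec_mem {S : ℤ} (z₀ : Zd P.d) {y : Zd P.d} (κ : Fin P.d) (h : y + unitVec κ ∈ box z₀ S) :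
    y ∈ box z₀ (S + 1) := by
  rw [mem_box] at h ⊢
  intro i
  have h1 := h i
  have hu : |(unitVec κ : Zd P.d) i| ≤ 1 := abs_unitVec_apply_le κ i
  have e1 : y i - z₀ i = (y + unitVec κ) i - z₀ i - (unitVec κ : Zd P.d) i := by simp only [Pi.add_apply]; ring
  rw [e1]
  exact (abs_sub _ _).trans (by linarith only [h1, hu])

/-- ★ **THE CURL-PAIRING OF THE PUSH, READ ON `ℤ^d`.**  `χ = 0` off `Q_{3R}(z₀)`, `aR = χ·at'`, `daR` its curl (so `daR = 0` off `Q_{3R+1}`), `F̂` an antisymmetric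
read-out whose `μ < ν` row is the plaquette function `G` at `⟨castSite y, μ, ν⟩`; then
`Σ_{z∈Π[lo,hi]} Σ_{μ<ν} (curl aR)(z,μ,ν)·G⟨castSite z,μ,ν⟩ = ½·Σ_{Q_{3R+2}}Σ_μΣ_ν daR·F̂`. [cite: Balaban1985Averaging, (9) p.18] -/
theorem sum_curl_readout_eq_half_box {lo hi : Fin P.d → ℤ} (z₀ : Zd P.d) (R : ℕ)
    (hlo : ∀ κ, lo κ = z₀ κ - (3 * (R : ℤ) + 2)) (hhi : ∀ κ, hi κ = z₀ κ + (3 * (R : ℤ) + 4))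
    (χ : Zd P.d → ℝ) (hχ0 : ∀ x, x ∉ box z₀ (3 * (R : ℤ)) → χ x = 0)
    (at' aR : Zd P.d → Fin P.d → ℝ) (haR : ∀ x ν, aR x ν = χ x * at' x ν) (daR : Zd P.d → Fin P.d → Fin P.d → ℝ)
    (hdaR : ∀ x μ ν, daR x μ ν = (aR (x + unitVec μ) ν - aR x ν) - (aR (x + unitVec ν) μ - aR x μ))
    (G : Plaq P 0 → ℝ) (Fh : Zd P.d → Fin P.d → Fin P.d → ℝ)
    (hFh : ∀ y (μ ν : Fin P.d) (h : μ < ν), Fh y μ ν = G ⟨castSite y, μ, ν, h⟩) (hFha : ∀ y μ ν, Fh y ν μ = -Fh y μ ν) :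
    ∑ z ∈ Fintype.piFinset (fun i => Finset.Icc (lo i) (hi i)), ∑ q : {q : Fin P.d × Fin P.d // q.1 < q.2},
        ((aR (z + unitVec q.1.1) q.1.2 - aR z q.1.2) - (aR (z + unitVec q.1.2) q.1.1 - aR z q.1.1)) * G ⟨castSite z, q.1.1, q.1.2, q.2⟩
      = (1 / 2) * ∑ y ∈ box z₀ (3 * (R : ℤ) + 2), ∑ μ, ∑ ν, daR y μ ν * Fh y μ ν := by
  have hdaR_anti : ∀ y μ ν, daR y ν μ = -daR y μ ν := fun y μ ν => by rw [hdaR, hdaR]; ring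
  have haR0 : ∀ x, x ∉ box z₀ (3 * (R : ℤ)) → ∀ ν, aR x ν = 0 := fun x hx ν => by rw [haR, hχ0 x hx, zero_mul]
  have hdaR0 : ∀ y, y ∉ box z₀ (3 * (R : ℤ) + 1) → ∀ μ ν, daR y μ ν = 0 := by
    intro y hy μ ν
    have hy0 : y ∉ box z₀ (3 * (R : ℤ)) := fun h => hy (box_mono z₀ (by omega) h)
    have hyμ : ∀ κ : Fin P.d, y + unitVec κ ∉ box z₀ (3 * (R : ℤ)) := fun κ h => hy (mem_box_succ_of_add_unitVec_mem z₀ κ h)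
    rw [hdaR, haR0 y hy0, haR0 y hy0, haR0 _ (hyμ μ), haR0 _ (hyμ ν)]; ring
  have hz : ∀ z, ∑ q : {q : Fin P.d × Fin P.d // q.1 < q.2},
      ((aR (z + unitVec q.1.1) q.1.2 - aR z q.1.2) - (aR (z + unitVec q.1.2) q.1.1 - aR z q.1.1)) * G ⟨castSite z, q.1.1, q.1.2, q.2⟩
      = (1 / 2) * ∑ μ, ∑ ν, daR z μ ν * Fh z μ ν := by
    intro z
    rw [UnitScaleGibbsChartPairingDictionary.sum_sum_eq_two_mul_sum_lt (daR z) (Fh z) (hdaR_anti z) (hFha z)]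
    rw [show (1 : ℝ) / 2 * (2 * ∑ q : {q : Fin P.d × Fin P.d // q.1 < q.2}, daR z q.1.1 q.1.2 * Fh z q.1.1 q.1.2) =
      ∑ q : {q : Fin P.d × Fin P.d // q.1 < q.2}, daR z q.1.1 q.1.2 * Fh z q.1.1 q.1.2 by ring]
    exact Finset.sum_congr rfl fun q _ => by rw [hdaR, hFh z q.1.1 q.1.2 q.2]
  simp only [hz]
  rw [← Finset.mul_sum]
  congr 1
  symm
  refine Finset.sum_subset (GrossTransferStubLinTestSDTerm.box_subset_piFinset z₀ R hlo hhi) fun y _ hy => ?_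
  have hy' : y ∉ box z₀ (3 * (R : ℤ) + 1) := fun h => hy (box_mono z₀ (by omega) h)
  exact Finset.sum_eq_zero fun μ _ => Finset.sum_eq_zero fun ν _ => by rw [hdaR0 y hy' μ ν, zero_mul]

/-! ## §3 The Schwinger–Dyson row in `ℤ^d` currency -/

/-- ★★★ **THE SCHWINGER–DYSON ROW OF R8-P8.**  On the `θ`-small dressing box (`PlaqSmallOn (boxPlaqs lo hi) θ U`, `hi ≤ lo + n`, `n < sitesPerDir`,
non-wrapping `hi − lo < sitesPerDir`, `lo = z₀ − (3R+2)`, `hi = z₀ + (3R+4)`), with `V := U^{axialGauge U lo hi}`, the truncated potential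
`aR = χ·at'` (`χ = 0` off `Q_{3R}`, margin-1 row), its curl `daR`, any push `u0` of `aR` (the two reading rows of ✓`exists_push`), and the
antisymmetrised Pauli read-out `F̂^α` of `V` (two rows):
`|∂_{u0•iσ_α}A(V) + ¼·Σ_{Q_{3R+2}}Σ_μΣ_ν daR·F̂^α| ≤ 14·((d−1)nθ)·θ·(4(d−1)·Σ_{Π[lo,hi]}Σ_μ|aR|)`.
[cite: GrossCMP1983, Thm 2.2] [cite: Balaban1985Averaging, (19)-(20) p.21] -/
theorem sd_term_abs_le (U : GaugeField P 0 (Matrix.specialUnitaryGroup (Fin 2) ℂ)) {lo hi : Fin P.d → ℤ} {θ : ℝ} {n : ℕ}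
    (hU : PlaqSmallOn (boxPlaqs lo hi) θ U) (hθ : 0 ≤ θ) (hn : ∀ κ, hi κ ≤ lo κ + n) (hnN : n < P.sitesPerDir 0)
    (hNbox : ∀ κ, hi κ - lo κ < P.sitesPerDir 0) (z₀ : Zd P.d) (R : ℕ)
    (hlo : ∀ κ, lo κ = z₀ κ - (3 * (R : ℤ) + 2)) (hhi : ∀ κ, hi κ = z₀ κ + (3 * (R : ℤ) + 4))
    (χ : Zd P.d → ℝ) (hχ0 : ∀ x, x ∉ box z₀ (3 * (R : ℤ)) → χ x = 0)
    (at' aR : Zd P.d → Fin P.d → ℝ) (haR : ∀ x ν, aR x ν = χ x * at' x ν) (daR : Zd P.d → Fin P.d → Fin P.d → ℝ)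
    (hdaR : ∀ x μ ν, daR x μ ν = (aR (x + unitVec μ) ν - aR x ν) - (aR (x + unitVec ν) μ - aR x μ))
    (haR1 : ∀ x μ, aR x μ ≠ 0 → lo + 1 ≤ x ∧ x + unitVec μ + 1 ≤ hi)
    (u0 : PBond P 0 → ℝ)
    (hu0 : ∀ (x : Fin P.d → ℤ) (μ : Fin P.d), lo ≤ x → x + e μ ≤ hi → u0 ⟨castSite x, μ⟩ = aR x μ)
    (hu0off : ∀ b : PBond P 0, (¬ ∃ y : Fin P.d → ℤ, lo ≤ y ∧ y + e b.dir ≤ hi ∧ b.src = castSite y) → u0 b = 0)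
    (α : Fin 3) (Fh : Zd P.d → Fin P.d → Fin P.d → ℝ)
    (hFh : ∀ y (μ ν : Fin P.d) (h : μ < ν), Fh y μ ν =
      ((I • pauli α) * (((GaugeField.plaqHol (GaugeField.gaugeAct (axialGauge U lo hi) U) ⟨castSite y, μ, ν, h⟩ :
        Matrix.specialUnitaryGroup (Fin 2) ℂ) : Matrix (Fin 2) (Fin 2) ℂ) - 1)).trace.re)
    (hFha : ∀ y μ ν, Fh y ν μ = -Fh y μ ν) :
    |actionDeriv (fundamentalRep (Fin 2)) (fun b => ((u0 b : ℝ) : ℂ) • (I • pauli α)) (GaugeField.gaugeAct (axialGauge U lo hi) U)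
        + 1 / 4 * ∑ y ∈ box z₀ (3 * (R : ℤ) + 2), ∑ μ, ∑ ν, daR y μ ν * Fh y μ ν|
      ≤ 14 * ((((P.d - 1 : ℕ) : ℝ) * n * θ)) * θ *
          (4 * ((P.d : ℝ) - 1) * ∑ x ∈ Fintype.piFinset (fun i => Finset.Icc (lo i) (hi i)), ∑ μ : Fin P.d, |aR x μ|) := by
  have h := UnitScaleGibbsTestFieldSU2DressingFlatPairing.abs_actionDeriv_push_dress_add_half_pairingZ_le U hU hθ hn hnN hNbox aR haR1 u0 hu0 hu0off α
  have e := sum_curl_readout_eq_half_box z₀ R hlo hhi χ hχ0 at' aR haR daR hdaR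
    (fun p => ((I • pauli α) * (((GaugeField.plaqHol (GaugeField.gaugeAct (axialGauge U lo hi) U) p :
      Matrix.specialUnitaryGroup (Fin 2) ℂ) : Matrix (Fin 2) (Fin 2) ℂ) - 1)).trace.re) Fh hFh hFha
  beta_reduce at e
  rw [e] at h
  rw [show (1 / 2 : ℝ) * ((1 / 2) * ∑ y ∈ box z₀ (3 * (R : ℤ) + 2), ∑ μ, ∑ ν, daR y μ ν * Fh y μ ν) =
    1 / 4 * ∑ y ∈ box z₀ (3 * (R : ℤ) + 2), ∑ μ, ∑ ν, daR y μ ν * Fh y μ ν by ring] at h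
  exact h

end Summit.QuantumFields.YangMills.Theorems.GrossTransferStubLinTestPointwisePairing

end
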